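import Summits.QuantumFields.BalabanUV.Beta.GAN24.LinT2ZeroMode
import Summits.QuantumFields.BalabanUV.Beta.GAN24.Push4

/-!
# `BalabanUV.Beta.GAN24.ZeroModeSandwichSiteDep` — binder row G-an2-4 ∕ (CONV-C), W-slot CT-route (the row owner gan24-p1 g23's R3 l.38143 «the honest
# object is the DRESSED tower's own charge law … the functional the dressed step actually conserves»; leaf-02 g52's suggestion S-leaf02-g52-1 ∕ memo
# `HOME/b2b-balaban-gan24-formalise-leaf-02/g52/ctw/CTW-FOURFACE-LOCATED-v1.md` §4): **THE SANDWICH CHARGE IDENTITY WITH SITE-DEPENDENT LEG PROFILES**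
# — leaf-02 g15's `ZeroModeSandwich.nested_integrand_eq` (the engine behind `LinT2ZeroMode.zmode_one_linT2`) with the three coarse leg sums allowed to
# DEPEND on the fine point they are read at: the eleven nested sums of the sandwich integrand equal
# `Σ_{g f κ κ′} Σ'_u h κ u · Σ'_{u′} Σ'_x Σ'_z T f g κ κ′ u u′ x z · (ca f x · (ch′ κ′ u′ · ck g z))` — the table paired with the LEG PROFILES

NOT IN PRINT; OUR BOOKKEEPING (G-an2-4 crux team (2), leaf prover `b2b-balaban-gan24-formalise-leaf-02`, gen 52).  WHY: for the UNDRESSED step kernel the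
coarse leg sums are site-free constants ((Q-lin)∕(S2c)) and the identity collapses to road W3's `zmode`-law; for the CO-DRESSED kernel they are the
face profiles `Π_bm 1 = N·𝟙_face` (gan24-p2 g36's `SandwichReadoutSiteDep.hasSum_coDressKBmAt_row ∕ _col`, leaf-02 g52's `CoProjSlotCharges`), and for
the k-fold DRESSED COMPOSITE transport (leaf-03 g57's `Push4LegTelescopeComb`: legs = `legChain (respStepBmSeq ρ Lc)`) they are the k-step response
profiles of the dressed chains to a constant coarse field — the candidates for the marginal functional `m^E` of the dressed dynamics.  This file is the
profile-blind Fubini core all three read-outs share: the majorant and the eleven-slot summability are leaf-02 g15's UNCHANGED (the profiles enter only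
through the three inner `HasSum`s — gan24-p2 g35∕g36's observation for the single sandwich).  HONEST FRAMING (cell contract, verbatim): «discharging
`BetaPertH` makes Bałaban's UV stability UNCONDITIONAL — a real constructive-QFT result; it is NOT the continuum limit and NOT the Clay problem.»  HONEST
DEPENDENCY (verbatim): «continuum YM on T⁴ ⇐ BetaPertH ∧ nine spine estimates (0/9 proved); BetaPertH ⇐ (D1) ∧ (D4) ∧ CAP+tail; G-an2-4 gates asym, D1 and
NE2/3/4.»  [folklore] absolutely convergent re-arrangement; generic `D`, `N ≥ 1`, finite fibre types `F`, `I`; 0 `def`, 0 cited facts, 0 `def … : Prop`,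
0 sorry.  Asserts NOTHING about any kernel or table of Bałaban's; discharges NOTHING of (hW, hWall) ∕ «T2Shape» ∕ (F3ᴱ-irr); NEVER «G-an2-4 closed» as
(CONV-C); NOT D1, NOT BetaPertH, NOT continuum, NOT Clay.

## What (leaf-02 g15's `integrand a h h′ T k`, five exponential leg bounds as there)
* `tsum_coarse_collapse_dep`: with `HasSum (x′ ↦ a f x′ x) (ca f x)`, `HasSum (y′ ↦ h′ κ′ y′ u′) (ch′ κ′ u′)`, `HasSum (z′ ↦ k g z z′) (ck g z)`:
  `Σ'_{y′} Σ'_{x′} Σ'_{z′} integrand … = (h κ u · T f g κ κ′ u u′ x z) · (ca f x · (ch′ κ′ u′ · ck g z))`.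
* **`nested_integrand_eq_dep`**: the eleven nested sums in the LEFT order
  `= Σ_{g f κ κ′} Σ'_u Σ'_{u′} Σ'_x Σ'_z (h κ u · T f g κ κ′ u u′ x z) · (ca f x · (ch′ κ′ u′ · ck g z))`.
* (the site-free case `ca f x := ca f` etc. IS leaf-02 g15's `ZeroModeSandwich.nested_integrand_eq` after `tsum_mul_left∕right` — not re-stated: the gate's dedup lint identifies the two.)
* §2 **`zmode_one_linT2_dep`**: the period-1 zero mode of leaf-02 g15's `linT2 K N T` for a decaying `K` with SITE-DEPENDENT coarse leg sums
  `HasSum (x′ ↦ K (N•x′) x (inr α) a) (ρL α a x)`, `HasSum (z′ ↦ K z (N•z′) b (inr β)) (ρR b β z)` and a `LocStencil₂` table (`δ > 0`; NO covariance needed):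
  `zmode 1 (linT2 K N T) μ ν (inl α) (inl β) = Σ_{g f κ κ′} Σ'_u Σ'_{u′} Σ'_x Σ'_z (colH K N μ 0 κ u · T κ u κ′ u′ x z f g) · (ρL α f x · (ρR (inl κ′) ν u′ · ρR g β z))`
  — `LinT2ZeroMode.zmode_one_linT2` stops being available exactly when the charges are site-dependent (leaf-02 g51's `not_exists_hasSum_source∕row_coDressKBm_KInvStep`);
  this is its replacement (the cell decomposition of the site-free case is not attempted).
* §3 **`zmode_one_push₄_dep`**: the same for leaf-17's four-leg push `push₄ l r X` through ARBITRARY leg families with exponential bounds and site-dependent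
  coarse sums `HasSum (x′ ↦ l α x′ κ x) (ρl α κ x)`, `HasSum (y ↦ r μ y κ u) (ρr μ κ u)`:
  `zmode 1 (push₄ l r X) μ ν (inl α) (inl β) = Σ_{g f κ κ′} Σ'_u Σ'_{u′} Σ'_x Σ'_z (r μ 0 κ u · X κ u κ′ u′ x z (inl f) (inl g)) · (ρl α f x · (ρr ν κ′ u′ · ρr β g z))`
  — the shape leaf-03 g57's `Push4LegTelescopeComb` puts the k-fold dressed composite transport in (legs = `legChain (respStepBmSeq ρ Lc)`, relative blocking `Lc^k`).
-/

noncomputable section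

open Finset
open scoped BigOperators
open Literature.MathematicalPhysics.QuantumFieldTheory
open Literature.MathematicalPhysics.QuantumFieldTheory.Balaban1983to89
open Literature.MathematicalPhysics.QuantumFieldTheory.Balaban1983to89.Beta
open B12Sec2to5 (l1)
open Summit.QuantumFields.BalabanUV.Beta.GAN24.ZeroModeFubini (nested_eleven_comm)
open ExpKernelCalculus (MKer Decays comp shiftK)
open OneStepResolventKernel (Fib wsum)
open OneStepKernelFamily (colH abs_colH_le vertexOfK)
open BalabanCompositeJets (LocStencil₂)
open SecondOrderResponse (vertex2OfK)
open BalabanStepJetsSucc (mmRead mmRead_inl_inl)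
open Summit.QuantumFields.BalabanUV.Beta.GAN24.BiStencilZeroMode (Tab zmode zmode_one)
open Summit.QuantumFields.BalabanUV.Beta.GAN24.ZeroModeSandwich (integrand summable_uncurryL_integrand)
open Summit.QuantumFields.BalabanUV.Beta.GAN24.LinT2ZeroMode (linT2 abs_le_of_locStencil₂)
open Summit.QuantumFields.BalabanUV.Beta.GAN24.Push4 (push₄ push₄_inl_inl vertex2W vertexW vertexW_apply)

namespace Summit.QuantumFields.BalabanUV.Beta.GAN24.ZeroModeSandwichSiteDep

variable {D N : ℕ} [NeZero N] {F I : Type*} [Fintype F] [Fintype I]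
variable {a : F → (Fin D → ℤ) → (Fin D → ℤ) → ℝ} {h : I → (Fin D → ℤ) → ℝ} {h' : I → (Fin D → ℤ) → (Fin D → ℤ) → ℝ}
  {T : F → F → I → I → (Fin D → ℤ) → (Fin D → ℤ) → (Fin D → ℤ) → (Fin D → ℤ) → ℝ} {k : F → (Fin D → ℤ) → (Fin D → ℤ) → ℝ}
  {Ca Ch Ch' CT Ck m δ : ℝ} {u₀ : Fin D → ℤ}

omit [NeZero N] [Fintype F] [Fintype I] in
/-- [folklore] **COLLAPSE OF THE THREE COARSE SUMS WITH SITE-DEPENDENT PROFILES**: if the left leg, the second column leg and the right leg have coarse sums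
`ca f x`, `ch′ κ′ u′`, `ck g z` (each MAY depend on the fine point it is read at), then for fixed `(z, g, x, f, κ, u, κ′, u′)`
`Σ'_{y′} Σ'_{x′} Σ'_{z′} integrand = (h κ u · T f g κ κ′ u u′ x z) · (ca f x · (ch′ κ′ u′ · ck g z))`. -/
theorem tsum_coarse_collapse_dep {ca : F → (Fin D → ℤ) → ℝ} {ch' : I → (Fin D → ℤ) → ℝ} {ck : F → (Fin D → ℤ) → ℝ}
    (has : ∀ f x, HasSum (fun x' => a f x' x) (ca f x)) (hhs : ∀ κ' u', HasSum (fun y' => h' κ' y' u') (ch' κ' u'))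
    (hks : ∀ g z, HasSum (fun z' => k g z z') (ck g z))
    (z : Fin D → ℤ) (g : F) (x : Fin D → ℤ) (f : F) (κ : I) (u : Fin D → ℤ) (κ' : I) (u' : Fin D → ℤ) :
    (∑' y', ∑' x', ∑' z', integrand a h h' T k y' x' z' z g x f κ u κ' u')
      = (h κ u * T f g κ κ' u u' x z) * (ca f x * (ch' κ' u' * ck g z)) := by
  have e : ∀ y' x' z', integrand a h h' T k y' x' z' z g x f κ u κ' u'
      = (h κ u * T f g κ κ' u u' x z) * (a f x' x * (h' κ' y' u' * k g z z')) := fun _ _ _ => by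
    simp only [integrand]; ring
  simp_rw [e]
  have hz : ∀ y' x', (∑' z', (h κ u * T f g κ κ' u u' x z) * (a f x' x * (h' κ' y' u' * k g z z')))
      = (h κ u * T f g κ κ' u u' x z) * (a f x' x * (h' κ' y' u' * ck g z)) := fun y' x' => by
    rw [tsum_mul_left, tsum_mul_left, tsum_mul_left, (hks g z).tsum_eq]
  simp_rw [hz]
  have hx : ∀ y', (∑' x', (h κ u * T f g κ κ' u u' x z) * (a f x' x * (h' κ' y' u' * ck g z)))
      = (h κ u * T f g κ κ' u u' x z) * (ca f x * (h' κ' y' u' * ck g z)) := fun y' => by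
    rw [tsum_mul_left, tsum_mul_right, (has f x).tsum_eq]
  simp_rw [hx]
  rw [tsum_mul_left, tsum_mul_left, tsum_mul_right, (hhs κ' u').tsum_eq]

/-- NOT IN PRINT; OUR BOOKKEEPING.  **THE SANDWICH CHARGE IDENTITY WITH SITE-DEPENDENT LEG PROFILES.**  Under leaf-02 g15's five exponential leg bounds
(absolute convergence on the eleven-slot product — `ZeroModeSandwich.summable_uncurryL_integrand`, profile-blind) and three coarse leg sums that MAY depend
on the fine point, the eleven nested sums of the sandwich integrand in the LEFT order equal
`Σ_{g f κ κ′} Σ'_u Σ'_{u′} Σ'_x Σ'_z (h κ u · T f g κ κ′ u u′ x z) · (ca f x · (ch′ κ′ u′ · ck g z))` — THE TABLE PAIRED WITH THE FOUR LEG PROFILES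
(the first column leg `h` itself, the second column leg's coarse sum `ch′`, the two sandwich legs' coarse sums `ca`, `ck`).  Site-free profiles give back
`ZeroModeSandwich.nested_integrand_eq`; face profiles give the four-face charge (PART 2 of this gen's certificate); k-step response profiles of the dressed
leg chains are the candidates for the marginal functional of the dressed transport. -/
theorem nested_integrand_eq_dep (hm : 0 < m) (hδ : 0 < δ)
    (ha : ∀ f x' x, |a f x' x| ≤ Ca * Real.exp (-m * l1 ((N : ℤ) • x' - x)))
    (hh : ∀ κ u, |h κ u| ≤ Ch * Real.exp (-m * l1 (u - u₀)))
    (hh' : ∀ κ' y' u', |h' κ' y' u'| ≤ Ch' * Real.exp (-m * l1 (u' - (N : ℤ) • y')))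
    (hT : ∀ f g κ κ' u u' x z, |T f g κ κ' u u' x z| ≤
      CT * (Real.exp (-δ * l1 (u' - u)) * Real.exp (-δ * l1 (x - u)) * Real.exp (-δ * l1 (z - u))))
    (hk : ∀ g z z', |k g z z'| ≤ Ck * Real.exp (-m * l1 (z - (N : ℤ) • z')))
    {ca : F → (Fin D → ℤ) → ℝ} {ch' : I → (Fin D → ℤ) → ℝ} {ck : F → (Fin D → ℤ) → ℝ}
    (has : ∀ f x, HasSum (fun x' => a f x' x) (ca f x)) (hhs : ∀ κ' u', HasSum (fun y' => h' κ' y' u') (ch' κ' u'))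
    (hks : ∀ g z, HasSum (fun z' => k g z z') (ck g z)) :
    (∑' y', ∑' x', ∑' z', ∑' z, ∑ g, ∑' x, ∑ f, ∑ κ, ∑' u, ∑ κ', ∑' u', integrand a h h' T k y' x' z' z g x f κ u κ' u')
      = ∑ g, ∑ f, ∑ κ, ∑ κ', ∑' u, ∑' u', ∑' x, ∑' z, (h κ u * T f g κ κ' u u' x z) * (ca f x * (ch' κ' u' * ck g z)) := by
  rw [nested_eleven_comm _ (summable_uncurryL_integrand hm hδ ha hh hh' hT hk)]
  refine Finset.sum_congr rfl fun g _ => Finset.sum_congr rfl fun f _ => Finset.sum_congr rfl fun κ _ =>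
    Finset.sum_congr rfl fun κ' _ => ?_
  refine tsum_congr fun u => tsum_congr fun u' => tsum_congr fun x => tsum_congr fun z => ?_
  exact tsum_coarse_collapse_dep has hhs hks z g x f κ u κ' u'

/-! ## §2 The period-1 zero mode of the linear second-order transport with site-dependent leg profiles -/

section LinT2

variable {d : ℕ} {N' : ℕ} [NeZero N']

/-- NOT IN PRINT; OUR BOOKKEEPING.  **THE ZERO MODE OF `linT2 K N T` WITH SITE-DEPENDENT LEG PROFILES** (decaying `K`, rate `m > 0`; a `LocStencil₂` table, rate
`δ > 0`; the multiplier-ROW coarse sums `ρL α a x` and multiplier-COLUMN coarse sums `ρR b β z` of `K` MAY depend on the fine point):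
`zmode 1 (linT2 K N T) μ ν (inl α) (inl β) = Σ_{g f κ κ′} Σ'_u Σ'_{u′} Σ'_x Σ'_z (colH K N μ 0 κ u · T κ u κ′ u′ x z f g) · (ρL α f x · (ρR (inl κ′) ν u′ · ρR g β z))`.
For the co-dressed step kernel the profiles are gan24-p2 g36's face-weighted ones (`SandwichReadoutSiteDep.hasSum_coDressKBmAt_row ∕ _col`). -/
theorem zmode_one_linT2_dep {K : MKer (d + 1) (Fib d)} {C m : ℝ} (hK : Decays K C m) (hm : 0 < m)
    {ρL : Fin (d + 1) → Fib d → (Fin (d + 1) → ℤ) → ℝ} {ρR : Fib d → Fin (d + 1) → (Fin (d + 1) → ℤ) → ℝ}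
    (hL : ∀ x α a, HasSum (fun x' : Fin (d + 1) → ℤ => K ((N' : ℤ) • x') x (Sum.inr α) a) (ρL α a x))
    (hR : ∀ z b β, HasSum (fun z' : Fin (d + 1) → ℤ => K z ((N' : ℤ) • z') b (Sum.inr β)) (ρR b β z))
    {T : Tab d} {CT δ : ℝ} (hT : LocStencil₂ T CT δ) (hδ : 0 < δ) (μ ν α β : Fin (d + 1)) :
    zmode 1 (linT2 K N' T) μ ν (Sum.inl α) (Sum.inl β)
      = ∑ g : Fib d, ∑ f : Fib d, ∑ κ : Fin (d + 1), ∑ κ' : Fin (d + 1),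
          ∑' u : Fin (d + 1) → ℤ, ∑' u' : Fin (d + 1) → ℤ, ∑' x : Fin (d + 1) → ℤ, ∑' z : Fin (d + 1) → ℤ,
            (colH K N' μ 0 κ u * T κ u κ' u' x z f g) * (ρL α f x * (ρR (Sum.inl κ') ν u' * ρR g β z)) := by
  rw [zmode_one]
  -- unfold the transported family to the nested sandwich form (as in `LinT2ZeroMode.zmode_one_linT2`)
  have push : ∀ y' x' z' : Fin (d + 1) → ℤ, linT2 K N' T μ 0 ν y' x' z' (Sum.inl α) (Sum.inl β)
      = ∑' z, ∑ g, ∑' x, ∑ f, ∑ κ, ∑' u, ∑ κ', ∑' u',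
          integrand (fun f x' x => K ((N' : ℤ) • x') x (Sum.inr α) f) (fun κ u => colH K N' μ 0 κ u) (fun κ' y' u' => colH K N' ν y' κ' u')
            (fun f g κ κ' u u' x z => T κ u κ' u' x z f g) (fun g z z' => K z ((N' : ℤ) • z') g (Sum.inr β)) y' x' z' z g x f κ u κ' u' := by
    intro y' x' z'
    simp only [linT2, mmRead_inl_inl, comp, vertex2OfK, vertexOfK, wsum, integrand]
    refine tsum_congr fun z => Finset.sum_congr rfl fun g _ => ?_
    rw [← tsum_mul_right]
    refine tsum_congr fun x => ?_
    rw [Finset.sum_mul]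
    refine Finset.sum_congr rfl fun f _ => ?_
    rw [Finset.mul_sum, Finset.sum_mul]
    refine Finset.sum_congr rfl fun κ _ => ?_
    rw [← tsum_mul_left, ← tsum_mul_right]
    refine tsum_congr fun u => ?_
    rw [Finset.mul_sum, Finset.mul_sum, Finset.sum_mul]
    refine Finset.sum_congr rfl fun κ' _ => ?_
    rw [← tsum_mul_left, ← tsum_mul_left, ← tsum_mul_right]
  simp_rw [push]
  rw [nested_integrand_eq_dep (N := N') (u₀ := (N' : ℤ) • (0 : Fin (d + 1) → ℤ)) hm hδ
    (fun f x' x => hK _ _ _ _) (fun κ u => abs_colH_le hK μ 0 κ u) (fun κ' y' u' => abs_colH_le hK ν y' κ' u')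
    (fun f g κ κ' u u' x z => abs_le_of_locStencil₂ hT κ u κ' u' x z f g) (fun g z z' => hK _ _ _ _)
    (fun f x => hL x α f) (fun κ' u' => hR u' (Sum.inl κ') ν) (fun g z => hR z g β)]

end LinT2

/-! ## §3 The period-1 zero mode of the four-leg push through arbitrary leg families with site-dependent profiles -/

section Push4

variable {d : ℕ} {N' : ℕ} [NeZero N']

/-- NOT IN PRINT; OUR BOOKKEEPING.  **THE ZERO MODE OF `push₄ l r X` WITH SITE-DEPENDENT LEG PROFILES** (leg families `l`, `r` with exponential bounds at
relative blocking `N′`, rate `m > 0`; a `LocStencil₂` table, rate `δ > 0`; coarse sums `ρl α κ x` of `l` over its coarse index and `ρr μ κ u` of `r` over its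
coarse index, BOTH allowed to depend on the fine point): `zmode 1 (push₄ l r X) μ ν (inl α) (inl β)
= Σ_{g f κ κ′} Σ'_u Σ'_{u′} Σ'_x Σ'_z (r μ 0 κ u · X κ u κ′ u′ x z (inl f) (inl g)) · (ρl α f x · (ρr ν κ′ u′ · ρr β g z))` — the table paired with the first leg at
coarse bond `(μ, 0)` and the three coarse-sum PROFILES of the other legs. -/
theorem zmode_one_push₄_dep {l r : Fin (d + 1) → (Fin (d + 1) → ℤ) → Fin (d + 1) → (Fin (d + 1) → ℤ) → ℝ} {Cl Cr m : ℝ} (hm : 0 < m)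
    (hlb : ∀ α x' κ x, |l α x' κ x| ≤ Cl * Real.exp (-m * l1 ((N' : ℤ) • x' - x)))
    (hrb : ∀ μ y κ u, |r μ y κ u| ≤ Cr * Real.exp (-m * l1 (u - (N' : ℤ) • y)))
    {ρl ρr : Fin (d + 1) → Fin (d + 1) → (Fin (d + 1) → ℤ) → ℝ}
    (hls : ∀ α κ x, HasSum (fun x' => l α x' κ x) (ρl α κ x)) (hrs : ∀ μ κ u, HasSum (fun y => r μ y κ u) (ρr μ κ u))
    {X : Tab d} {CT δ : ℝ} (hX : LocStencil₂ X CT δ) (hδ : 0 < δ) (μ ν α β : Fin (d + 1)) :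
    zmode 1 (push₄ l r X) μ ν (Sum.inl α) (Sum.inl β)
      = ∑ g : Fin (d + 1), ∑ f : Fin (d + 1), ∑ κ : Fin (d + 1), ∑ κ' : Fin (d + 1),
          ∑' u : Fin (d + 1) → ℤ, ∑' u' : Fin (d + 1) → ℤ, ∑' x : Fin (d + 1) → ℤ, ∑' z : Fin (d + 1) → ℤ,
            (r μ 0 κ u * X κ u κ' u' x z (Sum.inl f) (Sum.inl g)) * (ρl α f x * (ρr ν κ' u' * ρr β g z)) := by
  rw [zmode_one]
  have push : ∀ y' x' z' : Fin (d + 1) → ℤ, push₄ l r X μ 0 ν y' x' z' (Sum.inl α) (Sum.inl β)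
      = ∑' z, ∑ g, ∑' x, ∑ f, ∑ κ, ∑' u, ∑ κ', ∑' u',
          integrand (fun f x' x => l α x' f x) (fun κ u => r μ 0 κ u) (fun κ' y' u' => r ν y' κ' u')
            (fun f g κ κ' u u' x z => X κ u κ' u' x z (Sum.inl f) (Sum.inl g)) (fun g z z' => r β z' g z) y' x' z' z g x f κ u κ' u' := by
    intro y' x' z'
    rw [push₄_inl_inl]
    simp only [vertex2W, vertexW_apply, integrand]
    refine tsum_congr fun z => Finset.sum_congr rfl fun g _ => ?_
    rw [← tsum_mul_right]
    refine tsum_congr fun x => ?_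
    rw [Finset.sum_mul]
    refine Finset.sum_congr rfl fun f _ => ?_
    rw [Finset.mul_sum, Finset.sum_mul]
    refine Finset.sum_congr rfl fun κ _ => ?_
    rw [← tsum_mul_left, ← tsum_mul_right]
    refine tsum_congr fun u => ?_
    rw [Finset.mul_sum, Finset.mul_sum, Finset.sum_mul]
    refine Finset.sum_congr rfl fun κ' _ => ?_
    rw [← tsum_mul_left, ← tsum_mul_left, ← tsum_mul_right]
  simp_rw [push]
  rw [nested_integrand_eq_dep (N := N') (u₀ := (N' : ℤ) • (0 : Fin (d + 1) → ℤ)) hm hδ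
    (fun f x' x => hlb α x' f x) (fun κ u => hrb μ 0 κ u) (fun κ' y' u' => hrb ν y' κ' u')
    (fun f g κ κ' u u' x z => abs_le_of_locStencil₂ hX κ u κ' u' x z (Sum.inl f) (Sum.inl g)) (fun g z z' => hrb β z' g z)
    (fun f x => hls α f x) (fun κ' u' => hrs ν κ' u') (fun g z => hrs β g z)]

end Push4

end Summit.QuantumFields.BalabanUV.Beta.GAN24.ZeroModeSandwichSiteDep

end
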